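import Mathlib
import HarnessLib
import Summits.ValiantsHypothesis.ValiantsHypothesis.Theorems.MonotoneRestorationOrbitRestorationQPCorePatternsPoly
import Summits.ValiantsHypothesis.ValiantsHypothesis.Theorems.MonotoneRestorationOrbitRestorationQPInjectivePlacements

/-!
# Injective placements of a polynomial local form are narrow (SPAN currency; INJ, polynomial version)

Route MonotoneRestoration, crux `OrbitRestorationQP` (stmt-ValiantsHypothesis-18293), SPAN-currency lane of the open
sub-rung A_∞ (`stub_sigmaPiSigmaValue`).  Helper (`--supports`), def-free.  Polynomial version of
`…InjectivePlacements.lean` / `…InjectivePlacementsTwoSided.lean` (which treat powers of an affine local form):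

* `sum_resp_mem_of_merge`, `sum_injective_mem_of_merge` — the inclusion–exclusion / component-merging mechanism of
  `CorePatterns.sum_resp_pow_affineLocalForm_mem_narrowSpan`, made GENERIC in the summand: if for every merging
  `π : Fin r ↠ Fin r'` the all-placements sum of `W (g ∘ π)` lies in a submodule `V`, then so does the sum of `W` over
  the placements respecting any set of pairs, and over the INJECTIVE placements;
* `aeval_atoms_comp_rows`, `aeval_atoms_comp_cols` — placing a polynomial `P` in the local atoms along `g ∘ π` is
  placing the merged polynomial `rename (merge π) P` along `g`; `rename_rowCol_aeval_atoms` — a row/column renaming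
  moves the placement;
* **`sum_injective_placements_aeval_mem_narrowSpan`** (row side) and
  **`sum_injective_injective_aeval_mem_narrowSpan`** (both sides) — for every polynomial `P` in the atoms `x_{ab}`,
  `R_a`, `C_b` of the core `Fin r × Fin c`, the sum over injective placements of `P(x_{φ a, ψ b}, R_{φ a}, C_{ψ b})`
  lies in `span_ℂ {hom_{F,n} : tw F ≤ r + c}` (engine: `CorePatterns.sum_placements_aeval_mem_narrowSpan`).

Lane note: needed for products of exactly permuted families of polynomial (bounded-core) local forms — the home of
the stabiliser-orbit products of eigen-factors in the twisted residue of the `ΠΣ` sub-rung.  No registered stub is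
closed; the crux and VP ≠ VNP are not moved. [folklore]
-/

noncomputable section

-- `Summit.ValiantsHypothesis.ValiantsHypothesis.…` is the tree's single-conjunct layout (Sub = Summit).
set_option linter.dupNamespace false

namespace Summit.ValiantsHypothesis.ValiantsHypothesis.Theorems

namespace CorePatterns

open MvPolynomial Finset Equiv
open Literature.Computability.AlgebraicComplexity (homPoly)
open Literature.Combinatorics.SimpleGraph (treewidth)

/-! ### Generic inclusion–exclusion: from merged all-placements sums to injective placements -/

/-- **Placements respecting a set of pairs, generic summand.**  If for every merging `π : Fin r → Fin r'` (surjective)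
the all-placements sum `Σ_g W (g ∘ π)` lies in `V`, then the sum of `W` over the placements constant on every pair of
`S` lies in `V` (merge along the connected components of the constraint graph). [folklore] -/
theorem sum_resp_mem_of_merge {M : Type*} [AddCommGroup M] [Module ℂ M] (V : Submodule ℂ M) (r n : ℕ)
    (W : (Fin r → Fin n) → M)
    (hW : ∀ (r' : ℕ) (π : Fin r → Fin r'), Function.Surjective π → (∑ g : Fin r' → Fin n, W (g ∘ π)) ∈ V)
    (S : Finset (Fin r × Fin r)) (hS : ∀ p ∈ S, p.1 ≠ p.2) :
    (∑ φ ∈ (univ : Finset (Fin r → Fin n)).filter (fun φ => ∀ p ∈ S, φ p.1 = φ p.2), W φ) ∈ V := by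
  classical
  set G : SimpleGraph (Fin r) := SimpleGraph.fromRel fun a a' => (a, a') ∈ S with hGdef
  set r' : ℕ := Fintype.card G.ConnectedComponent with hr'
  set e : G.ConnectedComponent ≃ Fin r' := Fintype.equivFin G.ConnectedComponent with he
  set π : Fin r → Fin r' := fun a => e (G.connectedComponentMk a) with hπ
  have hπsurj : Function.Surjective π := by
    intro i
    obtain ⟨a, ha⟩ := Quot.exists_rep (e.symm i)
    refine ⟨a, ?_⟩
    simp only [hπ]
    rw [show G.connectedComponentMk a = e.symm i from ha, Equiv.apply_symm_apply]
  have hconst : ∀ φ : Fin r → Fin n, (∀ p ∈ S, φ p.1 = φ p.2) →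
      ∀ v w : Fin r, G.Reachable v w → φ v = φ w := by
    intro φ hφ v w hvw
    rw [SimpleGraph.reachable_iff_reflTransGen] at hvw
    induction hvw with
    | refl => rfl
    | tail _ hadj ih =>
      rw [ih]
      rw [hGdef, SimpleGraph.fromRel_adj] at hadj
      rcases hadj.2 with h | h
      · exact hφ _ h
      · exact (hφ _ h).symm
  have himage : (univ : Finset (Fin r → Fin n)).filter (fun φ => ∀ p ∈ S, φ p.1 = φ p.2) =
      (univ : Finset (Fin r' → Fin n)).image (fun g => g ∘ π) := by
    ext φ
    simp only [Finset.mem_filter, Finset.mem_univ, true_and, Finset.mem_image]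
    constructor
    · intro hφ
      refine ⟨(SimpleGraph.ConnectedComponent.lift φ fun v w p _ => hconst φ hφ v w p.reachable) ∘ e.symm, ?_⟩
      funext a
      simp [hπ]
    · rintro ⟨g, rfl⟩ p hp
      simp only [Function.comp_apply, hπ]
      rw [SimpleGraph.ConnectedComponent.connectedComponentMk_eq_of_adj]
      rw [hGdef, SimpleGraph.fromRel_adj]
      exact ⟨hS p hp, Or.inl (by simpa using hp)⟩
  have hinj : Set.InjOn (fun g : Fin r' → Fin n => g ∘ π) ↑(univ : Finset (Fin r' → Fin n)) :=
    fun g _ g' _ h => hπsurj.injective_comp_right h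
  rw [himage, Finset.sum_image hinj]
  exact hW r' π hπsurj

/-- **Injective placements, generic summand**: under the same merging hypothesis, the sum of `W` over the INJECTIVE
placements lies in `V` (inclusion–exclusion over pair sets, `sum_filter_injective_eq_sum_powerset`). [folklore] -/
theorem sum_injective_mem_of_merge {M : Type*} [AddCommGroup M] [Module ℂ M] (V : Submodule ℂ M) (r n : ℕ)
    (W : (Fin r → Fin n) → M)
    (hW : ∀ (r' : ℕ) (π : Fin r → Fin r'), Function.Surjective π → (∑ g : Fin r' → Fin n, W (g ∘ π)) ∈ V) :
    (∑ φ ∈ (univ : Finset (Fin r → Fin n)).filter (fun φ => Function.Injective φ), W φ) ∈ V := by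
  rw [sum_filter_injective_eq_sum_powerset]
  refine Submodule.sum_mem _ fun S hS => ?_
  refine zsmul_mem ?_ _
  refine sum_resp_mem_of_merge V r n W hW S fun p hp => ?_
  exact ne_of_lt (Finset.mem_filter.1 (Finset.mem_powerset.1 hS hp)).2

/-! ### Placing a polynomial in the local atoms -/

/-- **Placing along `g ∘ π` (rows) = placing the row-merged polynomial along `g`.** [folklore] -/
theorem aeval_atoms_comp_rows (n r r' c : ℕ) (P : MvPolynomial ((Fin r × Fin c) ⊕ (Fin r ⊕ Fin c)) ℂ)
    (π : Fin r → Fin r') (g : Fin r' → Fin n) (ψ : Fin c → Fin n) :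
    aeval (Sum.elim (fun ab : Fin r × Fin c => (X ((g ∘ π) ab.1, ψ ab.2) : MvPolynomial (Fin n × Fin n) ℂ))
        (Sum.elim (fun a : Fin r => ∑ j : Fin n, (X ((g ∘ π) a, j) : MvPolynomial (Fin n × Fin n) ℂ))
          (fun b : Fin c => ∑ j : Fin n, (X (j, ψ b) : MvPolynomial (Fin n × Fin n) ℂ)))) P =
      aeval (Sum.elim (fun ab : Fin r' × Fin c => (X (g ab.1, ψ ab.2) : MvPolynomial (Fin n × Fin n) ℂ))
        (Sum.elim (fun a : Fin r' => ∑ j : Fin n, (X (g a, j) : MvPolynomial (Fin n × Fin n) ℂ))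
          (fun b : Fin c => ∑ j : Fin n, (X (j, ψ b) : MvPolynomial (Fin n × Fin n) ℂ))))
        (rename (Sum.map (Prod.map π id) (Sum.map π id)) P) := by
  rw [aeval_rename]
  congr 1
  refine MvPolynomial.algHom_ext fun t => ?_
  rw [aeval_X, aeval_X]
  rcases t with ⟨a, b⟩ | a | b <;> rfl

/-- **Placing along `g ∘ π` (columns) = placing the column-merged polynomial along `g`.** [folklore] -/
theorem aeval_atoms_comp_cols (n r c c' : ℕ) (P : MvPolynomial ((Fin r × Fin c) ⊕ (Fin r ⊕ Fin c)) ℂ)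
    (π : Fin c → Fin c') (φ : Fin r → Fin n) (g : Fin c' → Fin n) :
    aeval (Sum.elim (fun ab : Fin r × Fin c => (X (φ ab.1, (g ∘ π) ab.2) : MvPolynomial (Fin n × Fin n) ℂ))
        (Sum.elim (fun a : Fin r => ∑ j : Fin n, (X (φ a, j) : MvPolynomial (Fin n × Fin n) ℂ))
          (fun b : Fin c => ∑ j : Fin n, (X (j, (g ∘ π) b) : MvPolynomial (Fin n × Fin n) ℂ)))) P =
      aeval (Sum.elim (fun ab : Fin r × Fin c' => (X (φ ab.1, g ab.2) : MvPolynomial (Fin n × Fin n) ℂ))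
        (Sum.elim (fun a : Fin r => ∑ j : Fin n, (X (φ a, j) : MvPolynomial (Fin n × Fin n) ℂ))
          (fun b : Fin c' => ∑ j : Fin n, (X (j, g b) : MvPolynomial (Fin n × Fin n) ℂ))))
        (rename (Sum.map (Prod.map id π) (Sum.map id π)) P) := by
  rw [aeval_rename]
  congr 1
  refine MvPolynomial.algHom_ext fun t => ?_
  rw [aeval_X, aeval_X]
  rcases t with ⟨a, b⟩ | a | b <;> rfl

/-- **A row/column renaming moves the placement of a polynomial in the local atoms.** [folklore] -/
theorem rename_rowCol_aeval_atoms (n r c : ℕ) (P : MvPolynomial ((Fin r × Fin c) ⊕ (Fin r ⊕ Fin c)) ℂ)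
    (φ : Fin r → Fin n) (ψ : Fin c → Fin n) (σ τ : Perm (Fin n)) :
    rename (fun Q : Fin n × Fin n => (σ Q.1, τ Q.2))
      (aeval (Sum.elim (fun ab : Fin r × Fin c => (X (φ ab.1, ψ ab.2) : MvPolynomial (Fin n × Fin n) ℂ))
        (Sum.elim (fun a : Fin r => ∑ j : Fin n, (X (φ a, j) : MvPolynomial (Fin n × Fin n) ℂ))
          (fun b : Fin c => ∑ j : Fin n, (X (j, ψ b) : MvPolynomial (Fin n × Fin n) ℂ)))) P) =
      aeval (Sum.elim (fun ab : Fin r × Fin c => (X ((⇑σ ∘ φ) ab.1, (⇑τ ∘ ψ) ab.2) : MvPolynomial (Fin n × Fin n) ℂ))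
        (Sum.elim (fun a : Fin r => ∑ j : Fin n, (X ((⇑σ ∘ φ) a, j) : MvPolynomial (Fin n × Fin n) ℂ))
          (fun b : Fin c => ∑ j : Fin n, (X (j, (⇑τ ∘ ψ) b) : MvPolynomial (Fin n × Fin n) ℂ)))) P := by
  rw [← AlgHom.comp_apply, comp_aeval]
  congr 1
  refine MvPolynomial.algHom_ext fun t => ?_
  rw [aeval_X, aeval_X]
  rcases t with ⟨a, b⟩ | a | b
  · simp only [Sum.elim_inl, rename_X, Function.comp_apply]
  · simp only [Sum.elim_inr, Sum.elim_inl, map_sum, rename_X, Function.comp_apply]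
    exact Equiv.sum_comp τ (fun j => (X (σ (φ a), j) : MvPolynomial (Fin n × Fin n) ℂ))
  · simp only [Sum.elim_inr, map_sum, rename_X, Function.comp_apply]
    exact Equiv.sum_comp σ (fun j => (X (j, τ (ψ b)) : MvPolynomial (Fin n × Fin n) ℂ))

/-! ### INJ for polynomials in the atoms -/

/-- **INJ, row side, polynomial version.**  For every polynomial `P` in the local atoms of the core `Fin r × Fin c`,
the sum over INJECTIVE row placements (all column placements) of `P(x_{φ a, ψ b}, R_{φ a}, C_{ψ b})` lies in
`span_ℂ {hom_{F,n} : tw F ≤ r + c}`. [folklore; cite: DwivediPagoSeppelt2026, §8] -/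
theorem sum_injective_placements_aeval_mem_narrowSpan (n r c : ℕ)
    (P : MvPolynomial ((Fin r × Fin c) ⊕ (Fin r ⊕ Fin c)) ℂ) :
    (∑ φ ∈ (univ : Finset (Fin r → Fin n)).filter (fun φ => Function.Injective φ), ∑ ψ : Fin c → Fin n,
      aeval (Sum.elim (fun ab : Fin r × Fin c => (X (φ ab.1, ψ ab.2) : MvPolynomial (Fin n × Fin n) ℂ))
        (Sum.elim (fun a : Fin r => ∑ j : Fin n, (X (φ a, j) : MvPolynomial (Fin n × Fin n) ℂ))
          (fun b : Fin c => ∑ j : Fin n, (X (j, ψ b) : MvPolynomial (Fin n × Fin n) ℂ)))) P) ∈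
    Submodule.span ℂ {p : MvPolynomial (Fin n × Fin n) ℂ |
        ∃ (a b : ℕ) (E : Multiset (Fin a × Fin b)),
          treewidth (SimpleGraph.fromRel fun u v : Fin a ⊕ Fin b =>
            ∃ e ∈ E, u = Sum.inl e.1 ∧ v = Sum.inr e.2) ≤ r + c ∧ p = homPoly E n ℂ} := by
  classical
  refine sum_injective_mem_of_merge _ r n _ fun r' π hπ => ?_
  have hr'le : r' ≤ r := by
    have := Fintype.card_le_of_surjective π hπ
    simpa using this
  simp_rw [aeval_atoms_comp_rows n r r' c P π]
  refine (Submodule.span_mono ?_)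
    (sum_placements_aeval_mem_narrowSpan n r' c (rename (Sum.map (Prod.map π id) (Sum.map π id)) P))
  rintro p ⟨a, b, E, hE, rfl⟩
  exact ⟨a, b, E, hE.trans (by omega), rfl⟩

/-- **INJ, both sides, polynomial version.**  For every polynomial `P` in the local atoms of the core `Fin r × Fin c`,
the sum over injective row AND injective column placements of `P(x_{φ a, ψ b}, R_{φ a}, C_{ψ b})` lies in
`span_ℂ {hom_{F,n} : tw F ≤ r + c}`. [folklore; cite: DwivediPagoSeppelt2026, §8] -/
theorem sum_injective_injective_aeval_mem_narrowSpan (n r c : ℕ)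
    (P : MvPolynomial ((Fin r × Fin c) ⊕ (Fin r ⊕ Fin c)) ℂ) :
    (∑ φ ∈ (univ : Finset (Fin r → Fin n)).filter (fun φ => Function.Injective φ),
      ∑ ψ ∈ (univ : Finset (Fin c → Fin n)).filter (fun ψ => Function.Injective ψ),
      aeval (Sum.elim (fun ab : Fin r × Fin c => (X (φ ab.1, ψ ab.2) : MvPolynomial (Fin n × Fin n) ℂ))
        (Sum.elim (fun a : Fin r => ∑ j : Fin n, (X (φ a, j) : MvPolynomial (Fin n × Fin n) ℂ))
          (fun b : Fin c => ∑ j : Fin n, (X (j, ψ b) : MvPolynomial (Fin n × Fin n) ℂ)))) P) ∈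
    Submodule.span ℂ {p : MvPolynomial (Fin n × Fin n) ℂ |
        ∃ (a b : ℕ) (E : Multiset (Fin a × Fin b)),
          treewidth (SimpleGraph.fromRel fun u v : Fin a ⊕ Fin b =>
            ∃ e ∈ E, u = Sum.inl e.1 ∧ v = Sum.inr e.2) ≤ r + c ∧ p = homPoly E n ℂ} := by
  classical
  rw [Finset.sum_comm]
  refine sum_injective_mem_of_merge _ c n _ fun c' π hπ => ?_
  have hc'le : c' ≤ c := by
    have := Fintype.card_le_of_surjective π hπ
    simpa using this
  simp_rw [aeval_atoms_comp_cols n r c c' P π]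
  rw [Finset.sum_comm]
  refine (Submodule.span_mono ?_)
    (sum_injective_placements_aeval_mem_narrowSpan n r c' (rename (Sum.map (Prod.map id π) (Sum.map id π)) P))
  rintro p ⟨a, b, E, hE, rfl⟩
  exact ⟨a, b, E, hE.trans (by omega), rfl⟩

end CorePatterns

end Summit.ValiantsHypothesis.ValiantsHypothesis.Theorems

end
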